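import Summits.BirchSwinnertonDyer.BirchSwinnertonDyer.Theses.InertBadSignedBranches
import Literature.NumberTheory.EllipticCurves.AnalyticRankModularityProofs
import HarnessLib

/-!
# Route `InertBadSignedBranches` (ISB), support item `PublishedFactsInert`
# (stmt-BirchSwinnertonDyer-19227): the SLIMMED dependency list — six conjuncts from FIVE children

D-0154 (2) INPUTS→UNCONDITIONAL, `INPUTS-LIST-2.md` §4 T1 «PackSlim» (cell `pub/bsd-wall`, seat
`bsd-inputs-pack-p1`). `PublishedFactsInert` is the conjunction of six published facts, item-stated as
the split children `EntireLFunctionRat` (19273), `GrossZagierRationalPointI73` (19369),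
`RankEqAnalyticRankLeOne` (19921), `PoitouTateRealRat` (19417), `PublishedInputNewform` (19382),
`PublishedInputManinOdd` (19383). Over the tree's LANDED theorems conjunct 1 (entireness of `L(E,s)`)
is redundant given conjunct 5 (the newform): `WeierstrassCurve.hasEntireLFunction_rat_of_exists_isNewformOf`
(`AnalyticRankModularityProofs.lean`; Diamond–Shurman Thm 8.8.3 ⇒ Thm 5.10.2).

Theorems: `publishedFactsInert_of_slim` — the pack from FIVE registered children (6 → 5); the in-route
edge `inertBadSignedBranches_entireLFunctionRat_of_publishedInputNewform`. HONEST FRAMING: pure glue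
over a landed theorem; no cite-only fact is proved here; the five inputs (Gross–Zagier I.7.3, GZK,
Poitou–Tate over ℚ, modularity, Mazur Cor. 4.1) stay print hypotheses and the route stays conditional
on them AS TYPED. Nothing here proves BSD; BSD is not proved by any of this.
-/

set_option autoImplicit false
set_option linter.dupNamespace false

namespace Summit.BirchSwinnertonDyer.BirchSwinnertonDyer.Theorems

open Literature.NumberTheory.EllipticCurves
open Summit.BirchSwinnertonDyer.BirchSwinnertonDyer.Theses.InertBadSignedBranches

/-- In-route edge (route `InertBadSignedBranches`): the newform child `PublishedInputNewform` (19382)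
gives `EntireLFunctionRat` (19273), by `WeierstrassCurve.hasEntireLFunction_rat_of_exists_isNewformOf`.
[folklore] -/
theorem inertBadSignedBranches_entireLFunctionRat_of_publishedInputNewform
    (hnf : PublishedInputNewform) :
    Summit.BirchSwinnertonDyer.BirchSwinnertonDyer.Theses.InertBadSignedBranches.EntireLFunctionRat :=
  WeierstrassCurve.hasEntireLFunction_rat_of_exists_isNewformOf hnf

/-- **`PublishedFactsInert` from five of its six children, BY NAME** (route `InertBadSignedBranches`,
item stmt-BirchSwinnertonDyer-19227; INPUTS-LIST-2 T1): `GrossZagierRationalPointI73`,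
`RankEqAnalyticRankLeOne`, `PoitouTateRealRat`, `PublishedInputNewform`, `PublishedInputManinOdd` imply
the six-conjunct pack, conjunct 1 (entire continuation) being the tree theorem
`inertBadSignedBranches_entireLFunctionRat_of_publishedInputNewform`. Pure glue; the five hypotheses
remain print inputs. [folklore] -/
theorem publishedFactsInert_of_slim
    (hGZ : GrossZagierRationalPointI73) (hGZK : RankEqAnalyticRankLeOne) (hPT : PoitouTateRealRat)
    (hnf : PublishedInputNewform) (hMazur : PublishedInputManinOdd) :
    Summit.BirchSwinnertonDyer.BirchSwinnertonDyer.Theses.InertBadSignedBranches.PublishedFactsInert :=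
  ⟨inertBadSignedBranches_entireLFunctionRat_of_publishedInputNewform hnf, hGZ, hGZK, hPT, hnf, hMazur⟩

end Summit.BirchSwinnertonDyer.BirchSwinnertonDyer.Theorems
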